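import Summits.ABC.IUTFork.Cor312PilotIdelesMRead
import HarnessLib

/-!
# [IUTchIII] Corollary 3.12, statement — the pilot ideles at the M-level presentation, READ ON THE VOLUME INPUT `I`
# (G1-Θ unit P4a, second file: the norms across the place cast stated on `I.tΘ` / `I.tq` themselves, as the
# G1-Θ lead asked for unit P6-ident, STATUS 09:52:59Z)

Record-only file (D-0012) of the abc-iut cell (seat abc-iut-w5-d033, gen 9; branch C «abc ⇐ S», C-R12 (e) target #2′).
TAKES NO SIDE on [IUTchIII] Cor. 3.12. PROOF-ONLY sequel of `Cor312PilotIdelesMRead` (p436273): there the ideles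
`tThetaM D p u hu r`, `tqM D p u hu r` at abc-iut-w5-d166's presentation `padicPresentationOfInitialDH` (P1) are read
off IDELE DATA `r : ThetaData.IdeleData D`, and a volume input `I` with `hI : IsVolumeInputOf D I` is reduced to its
idele data `ideleDataOf D hI` (`I = volumeInputOf D (ideleDataOf D hI)`). HERE the same numbers are stated on `I`:

* `volumeInputOf_injective`, `ideleDataOf_volumeInputOf` (the chosen idele data of `volumeInputOf D r` ARE `r`);
* `lstar_eq_of_isVolumeInputOf` (the index cast `Fin I.X.lstar = Fin ℓ⋇`);
* **`norm_tThetaM_ideleDataOf`**: `‖tThetaM D p u hu (ideleDataOf D hI) i x‖ = ‖I.tΘ p _ i v(x)‖` and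
  **`norm_tqM_ideleDataOf`** — the norm ACROSS the one place cast `liftPlace D v(x) = 𝔭_{w(x)}`, on the input's own
  ideles in `K_{v̲(x)} = (I.σ.localFieldFamily p).k v(x)` (abc-iut-S2 `CompletionLocalFields`);
* `log_norm_tThetaM_ideleDataOf` (Dupuy–Hilado (3.4) on the input).

[cite: DupuyHilado2025, §3.4, §3.9] [cite: Mochizuki2012, IUTchI Def. 3.1 (c)(e) p. 61–62]
[claim: Mochizuki2012, status: disputed] for the quoted setting. HONEST FRAMING: bookkeeping over OUR typed objects;
nothing here bears on the truth of [IUTchIII] Cor. 3.12; typed ≠ proved; instantiated ≠ endorsed.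
-/

noncomputable section

open Set Function NumberField IsDedekindDomain
open scoped Pointwise

namespace Summit.ABC.IUTFork.Thm311.Real

open Cor312Vol Literature.IUT.LogThetaLattice Literature.IUT.LogVolume Literature.IUT.HodgeTheaters
  Literature.NumberTheory.NumberFields

variable {F K Fbar : Type} [Field F] [NumberField F] [Field K] [NumberField K] [Algebra F K]
  [Field Fbar] [Algebra F Fbar] [Algebra K Fbar] {E : WeierstrassCurve F} [E.IsElliptic] {l : ℕ}
  {Pb : BadPlacePredicates K} (D : InitialThetaData F K Fbar E l Pb)
  (p : ℕ) [hp : Fact p.Prime] (u : FinitePlace ℚ) (hu : ((p : ℕ) : 𝓞 ℚ) ∈ (FinitePlace.maximalIdeal u).asIdeal)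

/-! ## §3c. The read-off stated on the volume input `I` itself (for unit P6's identification) -/

section Input

variable {D}

/-- `volumeInputOf D` is injective: the idele data of a volume input are determined by it. [folklore] -/
theorem volumeInputOf_injective : Function.Injective (ThetaData.volumeInputOf D) := by
  rintro ⟨tΘ, hΘ, tq, hq⟩ ⟨tΘ', hΘ', tq', hq'⟩ h
  simp only [ThetaData.volumeInputOf, ThetaVolumeInput.mk.injEq, heq_eq_eq, true_and] at h
  obtain ⟨rfl, rfl⟩ := h
  rfl

/-- The idele data chosen for `volumeInputOf D r` are `r`. [folklore] -/
theorem ideleDataOf_volumeInputOf (r : ThetaData.IdeleData D) :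
    ideleDataOf D (ThetaData.isVolumeInputOf_volumeInputOf D r) = r :=
  (volumeInputOf_injective (eq_volumeInputOf_ideleDataOf D (ThetaData.isVolumeInputOf_volumeInputOf D r))).symm

variable (D)

/-- For a volume input of `D`, the procession length of its pilot data is `ℓ⋇` of the index skeleton (both are
`(l − 1)/2`). [cite: Mochizuki2012, IUTchI Def. 3.1 (c) p. 61] -/
theorem lstar_eq_of_isVolumeInputOf {I : ThetaVolumeInput (fieldOfModuli E) K} (hI : ThetaData.IsVolumeInputOf D I) :
    I.X.lstar = (thetaIndexOfInitial D).lstar := by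
  rw [hI.X_eq]
  rfl

/-- **`‖tThetaM‖ = ‖I.tΘ‖` ACROSS THE CAST, on the input**: for a volume input `I` of `D`, the Θ-idele at the
presentation (read through `ideleDataOf D hI`) has the norm of `I`'s own idele `t_{Θ,i+1,v(x)} ∈ K_{v̲(x)}`.
[cite: DupuyHilado2025, §3.9] -/
theorem norm_tThetaM_ideleDataOf {I : ThetaVolumeInput (fieldOfModuli E) K} (hI : ThetaData.IsVolumeInputOf D I)
    (i : Fin (thetaIndexOfInitial D).lstar) (x : (thetaIndexOfInitial D).Fibre (Val.non u)) :
    ‖tThetaM D p u hu (ideleDataOf D hI) i x‖ =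
      ‖((I.tΘ p hp.out (Fin.cast (lstar_eq_of_isVolumeInputOf D hI).symm i) (placeOverOfFibreM D p u hu x) :
        ((I.σ.localFieldFamily p hp.out).k (placeOverOfFibreM D p u hu x))ˣ) :
          (I.σ.localFieldFamily p hp.out).k (placeOverOfFibreM D p u hu x))‖ := by
  obtain ⟨r, rfl⟩ := ThetaData.exists_eq_volumeInputOf D hI
  rw [ideleDataOf_volumeInputOf, norm_tThetaM]
  rfl

/-- **`‖tqM‖ = ‖I.tq‖` across the cast, on the input** (first procession degree). [cite: DupuyHilado2025, §3.9] -/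
theorem norm_tqM_ideleDataOf {I : ThetaVolumeInput (fieldOfModuli E) K} (hI : ThetaData.IsVolumeInputOf D I)
    (x : (thetaIndexOfInitial D).Fibre (Val.non u)) :
    ‖tqM D p u hu (ideleDataOf D hI) x‖ =
      ‖((I.tq p hp.out (Fin.cast (lstar_eq_of_isVolumeInputOf D hI).symm (firstIdx D))
          (placeOverOfFibreM D p u hu x) :
        ((I.σ.localFieldFamily p hp.out).k (placeOverOfFibreM D p u hu x))ˣ) :
          (I.σ.localFieldFamily p hp.out).k (placeOverOfFibreM D p u hu x))‖ := by
  obtain ⟨r, rfl⟩ := ThetaData.exists_eq_volumeInputOf D hI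
  rw [ideleDataOf_volumeInputOf, norm_tqM]
  rfl

/-- **`ht` on the input**: `log ‖tThetaM‖ = −P_{Θ,i+1}(v(x))·ln|κ(v(x))|/n_{v(x)}` with `P_Θ` read off `I`'s own
pilot data `I.X` (= `pilotData D`). [cite: DupuyHilado2025, §3.4, §3.9] -/
theorem log_norm_tThetaM_ideleDataOf {I : ThetaVolumeInput (fieldOfModuli E) K}
    (hI : ThetaData.IsVolumeInputOf D I) (i : Fin (thetaIndexOfInitial D).lstar)
    (x : (thetaIndexOfInitial D).Fibre (Val.non u)) :
    Real.log ‖tThetaM D p u hu (ideleDataOf D hI) i x‖ =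
      -((ThetaData.pilotData D).thetaPilot i (placeModOfM D u x)) * logNorm (fieldOfModuli E) (placeModOfM D u x) /
        localDegree (fieldOfModuli E) (placeModOfM D u x) :=
  log_norm_tThetaM D p u hu _ i x

end Input

end Summit.ABC.IUTFork.Thm311.Real

end
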